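import Mathlib.Geometry.Manifold.Complex
import Mathlib.Geometry.Manifold.Riemannian.Basic
import Mathlib.Geometry.Manifold.VectorBundle.Riemannian
import Mathlib.Analysis.Normed.Module.Multilinear.Curry
import Mathlib.Topology.Algebra.Module.Alternating.Basic
import Mathlib.Analysis.Calculus.ContDiff.Operations
import Literature.Geometry.Kaehler.ManifoldForms
import HarnessLib

-- provenance: harness21/H21/H21/Prelude/Kaehler/Kaehler.lean @ 0f964ca (interim HEAD d8f2665); M5 mechanical rewrite
/-!
# Hermitian and Kähler metrics on complex manifolds

Trunk: Kähler / Hodge (`H21/Outlines/Kaehler.md`, §K5 and design notes D4/D5); notion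
`kaehler_metric`.

A complex manifold `M` modelled on a finite-dimensional complex normed space `E` is regarded as
a real manifold with the *same charts*, `E` being a real normed space through Mathlib's instance
`NormedSpace.complexToReal` (design note D4). We assume both `[IsManifold 𝓘(ℂ, E) ω M]` and
`[IsManifold 𝓘(ℝ, E) ∞ M]`; the second is a consequence of the first
(`Literature.Geometry.Kaehler.isManifold_real_of_isManifold_complex`) but is *not* registered as an instance. Then
`TangentSpace 𝓘(ℝ, E) x = E = TangentSpace 𝓘(ℂ, E) x` definitionally, all of Mathlib's real
Riemannian machinery (`Bundle.RiemannianMetric`, `Bundle.ContMDiffRiemannianMetric`) applies to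
the real tangent bundle, and the complex structure is the explicit operator
`Literature.Geometry.Kaehler.tangentJ E x`
(multiplication by `i`, as a real continuous linear map of the tangent space).

## Main definitions

* `Literature.Geometry.Kaehler.tangentJ E x`: the almost-complex structure `J = i • id` on `TangentSpace 𝓘(ℝ, E) x`.
* `Bundle.RiemannianMetric.IsHermitian g`: `g(Jv, Jw) = g(v, w)` (a Hermitian metric, D5:
  a `Prop`-valued predicate on Mathlib's metric data, not a new structure; a definition, not a
  named fact: `Literature.Geometry.Kaehler.not_forall_isHermitian` exhibits a non-Hermitian metric on `ℂ`).
* `Bundle.RiemannianMetric.kaehlerForm g : Literature.Geometry.Kaehler.MForm 𝓘(ℝ, E) M ℝ 2`: the fundamental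
  (Kähler) `2`-form, the antisymmetrisation `½ (g(Jv, w) - g(Jw, v))` of `g(J·, ·)`, built on
  `E` with Mathlib's `ContinuousMultilinearMap.alternatization` (the tangent space carries no
  `NormedAddCommGroup` instance, so instance search happens on `E` and the result is returned at
  the tangent-space type).
* `Bundle.RiemannianMetric.IsKaehler g`: Hermitian with closed Kähler form
  (closedness is `Literature.Geometry.Kaehler.IsClosedForm`, i.e. the honest manifold exterior derivative `mextDeriv`).
* `Bundle.ContMDiffRiemannianMetric.kaehlerClass g hg :
  Literature.Geometry.Kaehler.deRhamCohomology 𝓘(ℝ, E) M ℝ 2`: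
  the Kähler class `[ω]`.
* `Literature.Geometry.Kaehler.IsKaehlerManifold E M`: `M` admits a smooth Kähler metric.

## Mathlib status

Mathlib (pinned v4.32.0) has complex manifolds (`Mathlib.Geometry.Manifold.Complex`), Riemannian
metrics on vector bundles and manifolds (`Bundle.RiemannianMetric`,
`Bundle.ContMDiffRiemannianMetric`, `riemannianMetricVectorSpace`), and the two-dimensional
precedent `Orientation.kahler`, but no Hermitian/Kähler metrics on manifolds; nothing here
duplicates a Mathlib declaration. The complex dimension is `Module.finrank ℂ E` inline (real
dimension via `finrank_real_of_complex`).

## Design notes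

* The declarations in the Mathlib namespaces `Bundle.RiemannianMetric` and
  `Bundle.ContMDiffRiemannianMetric` are **deliberate dot-notation extensions** (they take a
  Mathlib metric as their head argument); they are written in a `namespace Bundle.RiemannianMetric`
  block opened outside `namespace Literature`, resp. as `def _root_.…`. Everything else is in
  `namespace Literature`.
* Hypotheses are minimal per declaration, as in Mathlib: `tangentJ`, `IsHermitian`,
  `kaehlerForm`, `IsKaehler` and their pointwise lemmas only need `[NormedSpace ℂ E]` and a
  `ChartedSpace E M` (the metric `g` is an explicit binder written in each signature, not a
  `variable`, so that the predicates `IsHermitian g`/`IsKaehler g` are visibly parametrised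
  definitions and not closed named facts `def X : Prop`); the full setting
  `[FiniteDimensional ℂ E] [IsManifold 𝓘(ℂ, E) ω M] [IsManifold 𝓘(ℝ, E) ∞ M]` is assumed by
  `isSmoothForm_kaehlerForm_of_isManifold_complex`, `kaehlerClass` and `IsKaehlerManifold`
  (smoothness of the Kähler form genuinely uses holomorphy of the transition maps, which must
  commute with `J`). `IsKaehlerManifold` and `isSmoothForm_kaehlerForm_of_isManifold_complex`
  carry the two complex hypotheses as explicit instance binders *of the declaration*, so that
  they are only stated for complex manifolds: a `class` only picks up the section variables its
  fields mention and a `def … : Prop` only those its body uses, so a section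
  `variable [IsManifold 𝓘(ℂ, E) ω M]` is silently dropped from both (this is what happened to
  the former named fact `isSmoothForm_kaehlerForm`, see *Correction* below).
* There is no `ℂ`-action on `TangentSpace 𝓘(ℝ, E) x`; one always goes through `tangentJ`.
* Forms are never named `ω` (a reserved token under `open scoped Manifold ContDiff`).
* Spelling `Kaehler` follows the trunk name (Mathlib has both `KaehlerDifferential` and
  `Orientation.kahler`).

## Correction (D-0014 provefact pass on `isSmoothForm_kaehlerForm`, 2026-08-14)

The M5 rewrite stated the smoothness of the Kähler form as a closed named fact
`Literature.Geometry.Kaehler.isSmoothForm_kaehlerForm` (body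
`∀ g : ContMDiffRiemannianMetric 𝓘(ℝ, E) ∞ E (fun x : M ↦ TangentSpace 𝓘(ℝ, E) x),
IsSmoothForm g.toRiemannianMetric.kaehlerForm`, verbatim that of the corrected fact below,
written after a section `variable [FiniteDimensional ℂ E] [IsManifold 𝓘(ℂ, E) ω M]`). Its
elaborated signature had the binders `E`, `M`, their normed-space and charted-space instances
and `[IsManifold 𝓘(ℝ, E) ∞ M]` only: the two complex section variables are not used by the
body, so Lean does not abstract them, contrary to the design note above. That fact was thus
**mis-stated as a `Prop` family**: it was stated for every real `C^∞` manifold modelled on a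
complex normed space, and in that generality it is false — on `M = ℂ` with the real-smooth,
non-holomorphic atlas `{id, conj}` and `chartAt` chosen discontinuously (`id` at the points with
rational real part, `conj` elsewhere) the flat metric is a `C^∞` Riemannian metric (its matrix
in either trivialisation is the constant `Re ⟪·, ·⟫`, `conj` being orthogonal), but the chart
representative at `x₀` (`Literature.Geometry.Kaehler.MForm.inChart`) of its Kähler form is
`± dx ∧ dy` according as `chartAt x = chartAt x₀` or not (`conj^* (dx ∧ dy) = -(dx ∧ dy)`), a
function continuous at no point — so no closed proof `isSmoothForm_kaehlerForm_holds` can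
exist. The **corrected statement**, with the complex-manifold hypotheses as instance binders of
the `def` itself, is `Literature.Geometry.Kaehler.isSmoothForm_kaehlerForm_of_isManifold_complex`
(same citation; at a complex manifold it is *definitionally* the old `Prop`, the bodies being
identical), and it is **proved** in `Literature/Geometry/Kaehler/KaehlerProofs.lean`
(`Literature.Geometry.Kaehler.isSmoothForm_kaehlerForm_of_isManifold_complex_holds`, from the
unconditional `Bundle.ContMDiffRiemannianMetric.isSmoothForm_kaehlerForm_toRiemannianMetric`,
which needs neither `FiniteDimensional ℂ E` nor a named-fact hypothesis). Its consumers —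
`kaehlerClass` here, and
`hasHardLefschetzProperty_kaehlerClass`, `exists_hasHardLefschetzProperty_of_kaehlerClass`,
`isSmoothForm_kaehlerFormPow`, `isClosedForm_kaehlerFormPow` of
`Literature/AlgebraicGeometry/Motives/HodgeDecomposition.lean` — take
`(h : isSmoothForm_kaehlerForm_of_isManifold_complex (E := E) (M := M))` and are fed that
theorem. The old `def`, first kept verbatim under `@[deprecated]` while its consumers were
migrated (provefact protocol: a mis-stated named fact is corrected under a new name, never
edited in place), has since been **deleted**: no module of the tree mentions it any more, and a
false closed `Prop` carrying a citation must not remain in `Literature` as citable, countable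
named-fact debt.

## References

* C. Voisin, *Hodge Theory and Complex Algebraic Geometry I* (2002), §3.1.1 (Lemma 3.3:
  Hermitian forms `h` ↔ real `(1,1)`-forms `ω = -Im h`, `g = Re h` exactly the `J`-invariant
  symmetric forms; Def. 3.4, Remark 3.5), §3.1.2 (Hermitian metrics; Def. 3.6: Kähler),
  §3.1.3 (Lemma 3.8).
* P. Griffiths, J. Harris, *Principles of Algebraic Geometry* (1978), pp. 27–29, 106–109.
* R. O. Wells, *Differential Analysis on Complex Manifolds* (1980), Ch. V §4.
-/

noncomputable section

open scoped Manifold ContDiff Topology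
open Bundle

namespace Literature.Geometry.Kaehler

section RealStructure

variable {E : Type*} [NormedAddCommGroup E] [NormedSpace ℂ E]
  {M : Type*} [TopologicalSpace M] [ChartedSpace E M]

/-- A complex manifold is a real `C^∞` manifold with the same charts: holomorphic transition
maps are real-smooth (`ContDiffOn.restrict_scalars`). This makes the standing hypothesis
`[IsManifold 𝓘(ℝ, E) ∞ M]` of this file dischargeable; it is deliberately *not* an instance.
Griffiths–Harris (1978), p. 14; Wells (1980), Ch. I §3. [cite: GriffithsHarris1978] -/
theorem isManifold_real_of_isManifold_complex [IsManifold 𝓘(ℂ, E) ω M] :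
    IsManifold 𝓘(ℝ, E) ∞ M := by
  have hle : contDiffGroupoid ω 𝓘(ℂ, E) ≤ contDiffGroupoid ∞ 𝓘(ℝ, E) := by
    rw [contDiffGroupoid, contDiffGroupoid]
    apply groupoid_of_pregroupoid_le
    intro f s hfs
    exact ((hfs.of_le le_top).restrict_scalars ℝ :)
  have : HasGroupoid M (contDiffGroupoid ∞ 𝓘(ℝ, E)) := hasGroupoid_of_le inferInstance hle
  exact IsManifold.mk' _ _ _

variable (E) in
/-- The (integrable almost-) complex structure of the complex manifold `M` on its real tangent
space at `x`: multiplication by `i`, `J = i • id : T_x M →L[ℝ] T_x M` (recall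
`TangentSpace 𝓘(ℝ, E) x = E` definitionally). Voisin (2002), §3.1 / Prop. 2.9;
Griffiths–Harris (1978), p. 16. [cite: Voisin2002] -/
def tangentJ (x : M) : TangentSpace 𝓘(ℝ, E) x →L[ℝ] TangentSpace 𝓘(ℝ, E) x :=
  ((Complex.I • ContinuousLinearMap.id ℂ E).restrictScalars ℝ : E →L[ℝ] E)

/-- `J v = i • v`, the scalar action being that of `E = TangentSpace 𝓘(ℝ, E) x` (the
right-hand side is spelled `HSMul.hSMul (β := E)` because the tangent-space type synonym carries
no `ℂ`-action; it elaborates and prints as `Complex.I • v`). Voisin (2002), §3.1. Deliberately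
not `@[simp]`: unfolding `J` is rarely the wanted normal form, and it would break the simp-normal
form of `tangentJ_tangentJ`. [cite: Voisin2002] -/
theorem tangentJ_apply (x : M) (v : TangentSpace 𝓘(ℝ, E) x) :
    tangentJ E x v = HSMul.hSMul (β := E) (γ := E) Complex.I v :=
  rfl

/-- `J² = -1` (Voisin (2002), §3.1; Griffiths–Harris (1978), p. 16). [cite: Voisin2002] -/
@[simp]
theorem tangentJ_tangentJ (x : M) (v : TangentSpace 𝓘(ℝ, E) x) :
    tangentJ E x (tangentJ E x v) = -v := by
  change (Complex.I • Complex.I • (show E from v) : E) = -(show E from v)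
  rw [smul_smul, Complex.I_mul_I, neg_one_smul]

end RealStructure

end Literature.Geometry.Kaehler

/-! ### Hermitian metrics, the Kähler form, Kähler metrics (dot-notation extensions) -/

namespace Bundle.RiemannianMetric

open Literature.Geometry.Kaehler

/- Pointwise (linear-algebra) notions: no smoothness or finite-dimensionality is needed here;
the full complex-manifold setting is assumed only from
`Literature.Geometry.Kaehler.isSmoothForm_kaehlerForm_of_isManifold_complex` on. -/
variable {E : Type*} [NormedAddCommGroup E] [NormedSpace ℂ E]
  {M : Type*} [TopologicalSpace M] [ChartedSpace E M]

/-- A Riemannian metric `g` on the real tangent bundle of a complex manifold is *Hermitian* if it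
is invariant under the complex structure: `g(Jv, Jw) = g(v, w)` for all tangent vectors. These
are exactly the real parts `g = Re h` of the Hermitian metrics `h = g - iω` (Voisin (2002),
§3.1.1, Lemma 3.3 and the paragraph after (3.1): "the forms `g` obtained in this way are exactly
those satisfying `g(Iu, Iv) = g(u, v)`"; §3.1.2: a Hermitian metric on `M` is such an `h_x` on
each tangent space). This is a *predicate* on metrics — the definition of "Hermitian metric",
with `g` an explicit argument — not a named fact: the flat metric of `ℂⁿ` satisfies it, a general
Riemannian metric on a complex manifold does not. Griffiths–Harris (1978), p. 27; Wells (1980),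
Ch. V §4. [cite: Voisin2002, §3.1.1 Lemma 3.3, §3.1.2] -/
def IsHermitian (g : RiemannianMetric (fun x : M ↦ TangentSpace 𝓘(ℝ, E) x)) : Prop :=
  ∀ (x : M) (v w : TangentSpace 𝓘(ℝ, E) x),
    g.inner x (tangentJ E x v) (tangentJ E x w) = g.inner x v w

/-- The fundamental (Kähler) `2`-form of a Riemannian metric `g` on a complex manifold: at `x`,
the alternating bilinear form `(v, w) ↦ ½ (g(Jv, w) - g(Jw, v))`, i.e. the antisymmetrisation of
`g(J·, ·)`; when `g` is Hermitian this is `ω(v, w) = g(Jv, w)`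
(`kaehlerForm_apply_of_isHermitian`). Built on the model space `E` via Mathlib's
`ContinuousMultilinearMap.alternatization` and returned at the tangent-space type.
Voisin (2002), §3.1.1, Lemma 3.3 (`ω = -Im h`); Griffiths–Harris (1978), pp. 27–29, 106.
[cite: Voisin2002] -/
def kaehlerForm (g : RiemannianMetric (fun x : M ↦ TangentSpace 𝓘(ℝ, E) x)) :
    MForm 𝓘(ℝ, E) M ℝ 2 := fun x ↦
  letI B : E →L[ℝ] E →L[ℝ] ℝ := (g.inner x).comp (tangentJ E x)
  letI β : E [⋀^Fin 2]→L[ℝ] ℝ := (2⁻¹ : ℝ) • ContinuousMultilinearMap.alternatization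
    (ContinuousLinearMap.uncurryLeft
      (((continuousMultilinearCurryFin1 ℝ E ℝ).symm : (E →L[ℝ] ℝ) →L[ℝ] _).comp B))
  β

/-- The Kähler form evaluates as `ω(v, w) = ½ (g(Jv, w) - g(Jw, v))` (unfolding of the
definition; Voisin (2002), §3.1.1). [cite: Voisin2002] -/
theorem kaehlerForm_apply (g : RiemannianMetric (fun x : M ↦ TangentSpace 𝓘(ℝ, E) x)) (x : M)
    (v w : TangentSpace 𝓘(ℝ, E) x) :
    g.kaehlerForm x ![v, w] =
      2⁻¹ * (g.inner x (tangentJ E x v) w - g.inner x (tangentJ E x w) v) := by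
  change (((2⁻¹ : ℝ) • ContinuousMultilinearMap.alternatization _ : E [⋀^Fin 2]→L[ℝ] ℝ))
    (show Fin 2 → E from ![v, w]) = _
  rw [ContinuousAlternatingMap.smul_apply,
    ContinuousMultilinearMap.alternatization_apply_apply]
  have huniv : (Finset.univ : Finset (Equiv.Perm (Fin 2))) = {1, Equiv.swap 0 1} := by decide
  rw [huniv, Finset.sum_pair (by decide)]
  simp [Equiv.Perm.sign_swap', Units.smul_def, sub_eq_add_neg]
  rfl

/-- For a Hermitian metric the Kähler form is `ω(v, w) = g(Jv, w)` (the antisymmetrisation is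
redundant since `g(J·, ·)` is already alternating). Voisin (2002), §3.1.1, Lemma 3.3;
Griffiths–Harris (1978), p. 28. [cite: Voisin2002] -/
theorem kaehlerForm_apply_of_isHermitian
    (g : RiemannianMetric (fun x : M ↦ TangentSpace 𝓘(ℝ, E) x)) (hg : g.IsHermitian) (x : M)
    (v w : TangentSpace 𝓘(ℝ, E) x) :
    g.kaehlerForm x ![v, w] = g.inner x (tangentJ E x v) w := by
  rw [kaehlerForm_apply]
  have h := hg x (tangentJ E x w) v
  rw [tangentJ_tangentJ, map_neg, neg_apply, g.symm x] at h
  linarith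

/-- The Kähler form of a Hermitian metric is `J`-invariant: `ω(Jv, Jw) = ω(v, w)`, i.e. `ω` is
a real `(1,1)`-form. Voisin (2002), §3.1.1, Lemma 3.3; Wells (1980), Ch. V §4. [cite: Voisin2002] -/
theorem IsHermitian.kaehlerForm_tangentJ_tangentJ
    {g : RiemannianMetric (fun x : M ↦ TangentSpace 𝓘(ℝ, E) x)} (hg : IsHermitian g) (x : M)
    (v w : TangentSpace 𝓘(ℝ, E) x) :
    g.kaehlerForm x ![tangentJ E x v, tangentJ E x w] = g.kaehlerForm x ![v, w] := by
  rw [kaehlerForm_apply_of_isHermitian g hg, kaehlerForm_apply_of_isHermitian g hg, hg]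

/-- The metric is recovered from the Kähler form: `g(v, w) = ω(v, Jw)` for a Hermitian metric.
Voisin (2002), §3.1; Griffiths–Harris (1978), p. 28. [cite: Voisin2002] -/
theorem IsHermitian.inner_eq_kaehlerForm_tangentJ
    {g : RiemannianMetric (fun x : M ↦ TangentSpace 𝓘(ℝ, E) x)} (hg : IsHermitian g) (x : M)
    (v w : TangentSpace 𝓘(ℝ, E) x) :
    g.inner x v w = g.kaehlerForm x ![v, tangentJ E x w] := by
  rw [kaehlerForm_apply_of_isHermitian g hg, hg]

/-- The Kähler form of a Hermitian metric is nondegenerate at every point (take `w = Jv`: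
`ω(v, Jv) = g(v, v) > 0`). Voisin (2002), §3.1; Griffiths–Harris (1978), p. 28. [cite: Voisin2002] -/
theorem IsHermitian.kaehlerForm_nondegenerate
    {g : RiemannianMetric (fun x : M ↦ TangentSpace 𝓘(ℝ, E) x)} (hg : IsHermitian g) (x : M)
    (v : TangentSpace 𝓘(ℝ, E) x) (hv : v ≠ 0) :
    ∃ w : TangentSpace 𝓘(ℝ, E) x, g.kaehlerForm x ![v, w] ≠ 0 :=
  ⟨tangentJ E x v, by rw [← hg.inner_eq_kaehlerForm_tangentJ]; exact (g.pos x v hv).ne'⟩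

/-- A Riemannian metric on the real tangent bundle of a complex manifold is *Kähler* if it is
Hermitian and its Kähler form is closed, `dω = 0` (closedness is `Literature.Geometry.Kaehler.IsClosedForm`, the honest
manifold exterior derivative). Meaningful for smooth `g` (the only use below, through
`Bundle.ContMDiffRiemannianMetric`): for a non-smooth metric closedness may hold by the junk
value `0` of Mathlib's `extDerivWithin` underlying `Literature.Geometry.Kaehler.mextDeriv`. Like `IsHermitian`, a
predicate on metrics (explicit argument `g`), not a named fact. Voisin (2002), §3.1.2,
Def. 3.6; Griffiths–Harris (1978), p. 107; Wells (1980), Ch. V, Def. 4.2.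
[cite: Voisin2002, Def. 3.6] -/
def IsKaehler (g : RiemannianMetric (fun x : M ↦ TangentSpace 𝓘(ℝ, E) x)) : Prop :=
  g.IsHermitian ∧ IsClosedForm g.kaehlerForm

/-- A Kähler metric is Hermitian. [folklore] -/
theorem IsKaehler.isHermitian
    {g : RiemannianMetric (fun x : M ↦ TangentSpace 𝓘(ℝ, E) x)} (hg : IsKaehler g) : IsHermitian g :=
  hg.1

/-- The Kähler form of a Kähler metric is closed (Voisin (2002), Def. 3.6). [cite: Voisin2002] -/
theorem IsKaehler.isClosedForm_kaehlerForm
    {g : RiemannianMetric (fun x : M ↦ TangentSpace 𝓘(ℝ, E) x)} (hg : IsKaehler g) :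
    IsClosedForm (kaehlerForm g) :=
  hg.2

end Bundle.RiemannianMetric

namespace Literature.Geometry.Kaehler

variable {E : Type*} [NormedAddCommGroup E] [NormedSpace ℂ E]
  {M : Type*} [TopologicalSpace M] [ChartedSpace E M] [IsManifold 𝓘(ℝ, E) ∞ M]

/-- The Kähler form of a smooth (`C^∞`) Riemannian metric on the real tangent bundle of a
complex manifold `M` (modelled on the finite-dimensional complex normed space `E`) is a smooth
`2`-form. Voisin (2002), §3.1.2 (p. 63: for a differentiable Hermitian metric `h`, "Lemma 3.3
can be applied with parameters" to give the real `2`-form of type `(1,1)`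
`ω = -Im h ∈ Ω^{1,1}_M ∩ Ω²_{M,ℝ}`); Griffiths–Harris (1978), p. 106. **Corrected statement**
of the former named fact `isSmoothForm_kaehlerForm` (mis-stated, now deleted; see *Correction*
in the module docstring):
the complex-manifold hypotheses `[FiniteDimensional ℂ E] [IsManifold 𝓘(ℂ, E) ω M]` are
instance binders of the `def` itself (as for `IsKaehlerManifold`), so that the `Prop` is only
stated for complex manifolds — smoothness of `ω` uses that the tangent coordinate changes of a
complex manifold are `ℂ`-linear, i.e. commute with `J`. Named fact (D-0014), proved in
`KaehlerProofs.lean` (`isSmoothForm_kaehlerForm_of_isManifold_complex_holds`); consumers take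
`(h : isSmoothForm_kaehlerForm_of_isManifold_complex (E := E) (M := M))` and are fed that
theorem. [cite: Voisin2002, §3.1.2] -/
def isSmoothForm_kaehlerForm_of_isManifold_complex [FiniteDimensional ℂ E]
    [IsManifold 𝓘(ℂ, E) ω M] : Prop :=
  ∀ (g : ContMDiffRiemannianMetric 𝓘(ℝ, E) ∞ E (fun x : M ↦ TangentSpace 𝓘(ℝ, E) x)),
    IsSmoothForm g.toRiemannianMetric.kaehlerForm

variable [FiniteDimensional ℂ E] [IsManifold 𝓘(ℂ, E) ω M]

/-- The Kähler class `[ω] ∈ H²_dR(M; ℝ)` of a smooth Kähler metric: the de Rham class of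
its (smooth, closed) Kähler form. Voisin (2002), §3.1 / §6.1; Griffiths–Harris (1978), p. 109.
Deliberate dot-notation extension of Mathlib's `Bundle.ContMDiffRiemannianMetric`.
Relies on the named fact `isSmoothForm_kaehlerForm_of_isManifold_complex` (explicit hypothesis
`h`, fed `Literature.Geometry.Kaehler.isSmoothForm_kaehlerForm_of_isManifold_complex_holds` of
`KaehlerProofs.lean`) and
`mem_closedSmoothForms_iff`. [cite: Voisin2002, §3.1] -/
def _root_.Bundle.ContMDiffRiemannianMetric.kaehlerClass
    (h : isSmoothForm_kaehlerForm_of_isManifold_complex (E := E) (M := M))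
    (g : ContMDiffRiemannianMetric 𝓘(ℝ, E) ∞ E (fun x : M ↦ TangentSpace 𝓘(ℝ, E) x))
    (hg : g.toRiemannianMetric.IsKaehler) : deRhamCohomology 𝓘(ℝ, E) M ℝ 2 :=
  deRhamCohomology.mk ⟨g.toRiemannianMetric.kaehlerForm,
    (mem_closedSmoothForms_iff _).2 ⟨h g, hg.2⟩⟩

variable (E M) in
/-- `M` is a *Kähler manifold*: the complex manifold `M` (modelled on `E`) admits a smooth
Riemannian metric on its real tangent bundle which is Kähler. Only existence is recorded (this is
what topological consequences such as Hard Lefschetz quantify over). Voisin (2002), Def. 3.6;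
Griffiths–Harris (1978), p. 109; Wells (1980), Ch. V, Def. 4.3. The complex-manifold
hypotheses are explicit binders: a `class` only picks up the section variables its fields
mention, and without holomorphic transition maps `tangentJ` would not be a tensor on `M`. [cite: Voisin2002] -/
class IsKaehlerManifold [FiniteDimensional ℂ E] [IsManifold 𝓘(ℂ, E) ω M] : Prop where
  /-- There is a smooth Kähler metric on `M`. -/
  exists_isKaehler :
    ∃ g : ContMDiffRiemannianMetric 𝓘(ℝ, E) ∞ E (fun x : M ↦ TangentSpace 𝓘(ℝ, E) x),
      g.toRiemannianMetric.IsKaehler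

/-! ### The flat model -/

section Flat

/-- Sanity check (flat model): on a finite-dimensional complex inner product space `V`, seen as a
real inner product space via `InnerProductSpace.complexToReal` and as a manifold modelled on
itself, Mathlib's standard Riemannian metric `riemannianMetricVectorSpace V` (`g = Re ⟪·, ·⟫`)
is Kähler: it is Hermitian, and its Kähler form `ω = -Im ⟪·, ·⟫` is constant, hence closed.
Voisin (2002), §3.1, Example; Griffiths–Harris (1978), p. 107 (`ℂⁿ` with the Euclidean
metric). [cite: Voisin2002] -/
def isKaehler_riemannianMetricVectorSpace : Prop :=
  ∀ (V : Type*) [NormedAddCommGroup V] [InnerProductSpace ℂ V] [FiniteDimensional ℂ V],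
    letI : InnerProductSpace ℝ V := InnerProductSpace.complexToReal
    (riemannianMetricVectorSpace V).toRiemannianMetric.IsKaehler

/-- Sanity check (flat model): a finite-dimensional complex normed space, as a complex manifold
modelled on itself, is a Kähler manifold (transport the Euclidean metric of `ℂⁿ`; cf.
`isKaehler_riemannianMetricVectorSpace`). A theorem, not an instance.
Griffiths–Harris (1978), p. 107. [cite: GriffithsHarris1978] -/
def isKaehlerManifold_vectorSpace : Prop :=
  ∀ (V : Type*) [NormedAddCommGroup V] [NormedSpace ℂ V] [FiniteDimensional ℂ V],
    IsKaehlerManifold V V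

end Flat

/-! ### `IsHermitian` is a predicate, not a claim -/

section NotAFact

/-- `Bundle.RiemannianMetric.IsHermitian` is a genuine predicate on metrics (the *definition* of
a Hermitian metric, Voisin (2002), §3.1.1, Lemma 3.3 / §3.1.2), not a universally valid
statement: on the real tangent bundle of `ℂ` (a complex manifold modelled on itself) the
Riemannian metric `B(v, w) = ⟪v, w⟫_ℝ + Re v · Re w` is not `J`-invariant,
`B(1, 1) = 2 ≠ 1 = B(i, i) = B(J1, J1)`. (The flat metric, on the other hand, is Hermitian:
`Literature.Geometry.Kaehler.isKaehler_riemannianMetricVectorSpace`.) [folklore] -/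
theorem not_forall_isHermitian :
    ¬ ∀ g : RiemannianMetric (fun x : ℂ ↦ TangentSpace 𝓘(ℝ, ℂ) x), g.IsHermitian := by
  intro h
  -- the distorted inner product `B(v, w) = ⟪v, w⟫_ℝ + Re v · Re w`
  let B : ℂ →L[ℝ] ℂ →L[ℝ] ℝ :=
    (innerSL ℝ : ℂ →L[ℝ] ℂ →L[ℝ] ℝ) +
      (ContinuousLinearMap.mul ℝ ℝ).bilinearComp Complex.reCLM Complex.reCLM
  have hB : ∀ v w : ℂ, B v w = inner ℝ v w + v.re * w.re := fun v w ↦ by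
    simp only [B, add_apply, ContinuousLinearMap.bilinearComp_apply,
      ContinuousLinearMap.mul_apply', Complex.reCLM_apply]
    rfl
  have hBself : ∀ v : ℂ, B v v = ‖v‖ ^ 2 + v.re * v.re := fun v ↦ by
    rw [hB, real_inner_self_eq_norm_sq]
  -- it is a Riemannian metric on the (trivial) real tangent bundle of `ℂ`
  let g : RiemannianMetric (fun x : ℂ ↦ TangentSpace 𝓘(ℝ, ℂ) x) :=
    { inner := fun _ ↦ B
      symm := fun _ v w ↦ by
        change B v w = B w v
        rw [hB, hB, real_inner_comm, mul_comm]
      pos := fun _ v hv ↦ by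
        change 0 < B v v
        rw [hBself]
        have : 0 < ‖(show ℂ from v)‖ := norm_pos_iff.2 hv
        nlinarith [mul_self_nonneg (show ℂ from v).re]
      continuousAt := fun _ ↦ by
        change ContinuousAt (fun v : ℂ ↦ B v v) 0
        exact (B.continuous₂.comp (continuous_id.prodMk continuous_id)).continuousAt
      isVonNBounded := fun _ ↦ by
        change Bornology.IsVonNBounded ℝ {v : ℂ | B v v < 1}
        refine (NormedSpace.isVonNBounded_ball ℝ ℂ 1).subset ?_
        intro v hv
        rw [Set.mem_setOf_eq, hBself] at hv
        rw [Metric.mem_ball, dist_zero_right]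
        nlinarith [mul_self_nonneg v.re, norm_nonneg v] }
  -- but `B(J1, J1) = B(i, i) = 1 ≠ 2 = B(1, 1)`
  have h1 := h g 0 (1 : ℂ) (1 : ℂ)
  rw [tangentJ_apply] at h1
  change B (Complex.I • (1 : ℂ)) (Complex.I • 1) = B 1 1 at h1
  rw [hBself, hBself] at h1
  norm_num at h1

end NotAFact

end Literature.Geometry.Kaehler
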